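import Literature.NumberTheory.GaloisRepresentations.PAdicHodge
import Mathlib.LinearAlgebra.Dimension.Constructions
import Mathlib.LinearAlgebra.FiniteDimensional.Lemmas
import Mathlib.LinearAlgebra.Basis.VectorSpace
import Mathlib.RingTheory.TensorProduct.Finite
import Mathlib.Topology.Instances.Rat
import HarnessLib

/-!
# `B`-admissibility is a genuine condition: the base period-ring datum `B = E`

`Literature.NumberTheory.GaloisRepresentations.PeriodRingData.IsAdmissible 𝔅 ρ`
(file `Literature.NumberTheory.GaloisRepresentations.PAdicHodge`) is Fontaine's **definition** of a
`B`-admissible representation — `dim_E D_B(V) = dim_P V` with `D_B(V) = (B ⊗_P V)^Γ`, `E = B^Γ`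
(Fontaine, Astérisque 223 (1994), Exposé III, §1.5; Fontaine–Ouyang, *Theory of `p`-adic Galois
representations*, §3.1.2) — i.e. a *predicate* on pairs (period-ring datum `𝔅`, representation
`ρ`), which specialises to *de Rham*, *Hodge–Tate*, *crystalline*, *semistable* for
`B = B_dR, B_HT, B_cris, B_st`.  It is not a closed proposition awaiting a proof: this file records
the elementary, fully proved facts locating the predicate between its two extremes, and in passing
gives the first inhabitant of the structure `PeriodRingData` (non-vacuity of Fontaine's regularity
axioms as formalised there).

* `PeriodRingData.trivial Γ P E`: the **base datum** `B := E` with the *trivial* action of `Γ`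
  and the trivial filtration (`Fil^i = E` for `i ≤ 0`, `Fil^i = 0` for `i > 0`).  It satisfies
  all of Fontaine's regularity axioms (`E` is a field, `E^Γ = E`).
* `PeriodRingData.finrank_trivial_tensor`: `dim_E (E ⊗_P M) = dim_P M`.
* `PeriodRingData.isAdmissible_trivial_of_forall_eq`: a representation on which `Γ` acts
  trivially is `E`-admissible (so the predicate is satisfiable:
  `PeriodRingData.isAdmissible_trivial_trivial` for `ContinuousRep.trivial`);
* `PeriodRingData.forall_eq_of_isAdmissible_trivial`, `PeriodRingData.isAdmissible_trivial_iff`: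
  conversely, for finite-dimensional `M`, `E`-admissibility forces `Γ` to act trivially on `M`
  (`D = E ⊗_P M` by the dimension count, and `m ↦ 1 ⊗ m` is injective,
  `PeriodRingData.one_tmul_injective`).  Informally: `D_E(V) = E ⊗_P V^Γ`.
* `PeriodRingData.signRep`: the sign character `n ↦ (-1)^n` of `Multiplicative ℤ` (discrete) on
  `ℚ`; `PeriodRingData.not_isAdmissible_trivial_signRep`: it is **not** admissible for the base
  datum `B = ℚ`; hence `PeriodRingData.not_forall_isAdmissible`: the universal closure
  `∀ 𝔅 ρ, 𝔅.IsAdmissible ρ` of the predicate is false.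

These are immediate consequences of the definitions (for `B = E` with trivial action the
invariants of `B ⊗_P V` contain `1 ⊗ V^Γ`, with equality of dimensions iff `Γ` acts trivially);
no single source states them as numbered results, so they are tagged folklore.  The genuine
*theorem* of `PAdicHodge.lean` about `D_B` — Fontaine's inequality `dim_E D_B(V) ≤ dim_P V`
(`PeriodRingData.finrank_D_le`) — is proved in the sibling file
`Literature.NumberTheory.GaloisRepresentations.PAdicHodgeProofs`.

## Design notes

* `PeriodRingData.trivial` is an ordinary (semireducible) `def`, **not** an `abbrev`: the
  `P`-module structure on `𝔅.B` used throughout `PAdicHodge.lean` is the derived one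
  (`PeriodRingData.instAlgebraP`, `c • b = algebraMap P E c * b`), which is only propositionally
  equal to the ambient `Algebra P E`-module structure on `E`; keeping `(trivial Γ P E).B` folded
  makes every instance on it come from the `PeriodRingData` projections, so that the generic
  lemmas (`tensorRep_apply_tmul`, `mem_D_iff`, …) apply verbatim.  The identification with `E`
  is definitional (`PeriodRingData.trivial_B`, `PeriodRingData.trivial_smul` are `rfl`).
* The trivial `MulSemiringAction` is a named `@[reducible] def`
  (`PeriodRingData.trivialMulSemiringAction`), never an instance (it would clash with genuine
  actions, e.g. of `Eˣ` on `E`).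
* `not_forall_isAdmissible` is stated at universe level `0` (all of `Γ, P, E, M` in `Type`), the
  level of the concrete counterexample `(Multiplicative ℤ, ℚ, ℚ, ℚ)`.

## References

* J.-M. Fontaine, *Représentations `p`-adiques semi-stables*, Astérisque 223 (1994), Exposé III,
  §1.4 (regular `(F, G)`-rings), §1.5 (`D_B`, `B`-admissible representations).
  [FontaineAsterisque223III]
* J.-M. Fontaine, Y. Ouyang, *Theory of `p`-adic Galois Representations*, book draft (2022),
  §3.1.2 (regular `(F, G)`-rings, `B`-admissible representations, Thm. 3.14).
  [FontaineOuyang2022]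
-/

noncomputable section

open scoped TensorProduct
open TensorProduct

namespace Literature.NumberTheory.GaloisRepresentations

namespace PeriodRingData

universe u v v' w'

/-! ### The base datum `B = E` -/

section Trivial

variable (Γ : Type u) [Group Γ] (P : Type v) (E : Type v') [Field P] [Field E] [Algebra P E]

/-- The **trivial action** of `Γ` on the field `E` by ring automorphisms (every `σ` acts as the
identity), as a `MulSemiringAction`.  A reducible definition, not an instance. [folklore] -/
@[reducible] def trivialMulSemiringAction : MulSemiringAction Γ E where
  smul _ e := e
  one_smul _ := rfl
  mul_smul _ _ _ := rfl
  smul_zero _ := rfl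
  smul_add _ _ _ := rfl
  smul_one _ := rfl
  smul_mul _ _ _ := rfl

/-- The **trivial filtration** on `E`: `Fil^i E = E` for `i ≤ 0` and `Fil^i E = 0` for `i > 0`
(decreasing, exhaustive, separated, multiplicative, with `gr^0 = E`). [folklore] -/
def trivialFil (i : ℤ) : Submodule E E := if i ≤ 0 then ⊤ else ⊥

/-- Unfolding lemma for `trivialFil` in non-positive degrees. [folklore] -/
@[simp] lemma trivialFil_of_nonpos {i : ℤ} (hi : i ≤ 0) : trivialFil E i = ⊤ := if_pos hi

/-- Unfolding lemma for `trivialFil` in positive degrees. [folklore] -/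
@[simp] lemma trivialFil_of_pos {i : ℤ} (hi : 0 < i) : trivialFil E i = ⊥ := if_neg (not_le.2 hi)

/-- The **base period-ring datum** `B = E` for the group `Γ`, coefficient field `P` and invariant
field `E ⊇ P`: the field `E` itself with the *trivial* action of `Γ`
(`trivialMulSemiringAction`) and the trivial filtration (`trivialFil`).  Fontaine's regularity
axioms hold trivially: `E` is a domain, `E^Γ = E` (`invariants_eq`), `b = (b / c) • c`
(`exists_smul_eq`), and every nonzero element is a unit (`isUnit_of_smul_mem`).  For this datum
`D_B(V) = (E ⊗_P V)^Γ` with `Γ` acting through `V` alone, and `B`-admissibility means that `Γ`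
acts trivially on `V` (`isAdmissible_trivial_iff`).  This is the simplest regular `(P, Γ)`-ring in
the sense of Fontaine, Astérisque 223 (1994), Exposé III, §1.4, and the first inhabitant of
`PeriodRingData`. [folklore] -/
def trivial : PeriodRingData.{u, v, v', v'} Γ P E where
  B := E
  action := trivialMulSemiringAction Γ E
  smulComm := letI := trivialMulSemiringAction Γ E; ⟨fun _ _ _ => rfl⟩
  invariants_eq := Set.ext fun b => ⟨fun _ => ⟨b, rfl⟩, fun _ _ => rfl⟩
  exists_smul_eq b c hc _ := ⟨b / c, by rw [smul_eq_mul, div_mul_cancel₀ b hc]⟩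
  isUnit_of_smul_mem b hb _ := hb.isUnit
  fil := trivialFil E
  fil_antitone i j hij := by
    by_cases hj : j ≤ 0
    · simp [hj, hij.trans hj]
    · simp [not_le.1 hj]
  mul_mem_fil i j x y hx hy := by
    by_cases hi : i ≤ 0
    · by_cases hj : j ≤ 0
      · simp [add_nonpos hi hj]
      · rw [trivialFil_of_pos E (not_le.1 hj), Submodule.mem_bot] at hy
        simp [hy]
    · rw [trivialFil_of_pos E (not_le.1 hi), Submodule.mem_bot] at hx
      simp [hx]
  one_mem_fil_zero := by simp
  smul_mem_fil _ _ _ hx := hx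
  iSup_fil := eq_top_iff.2 (le_iSup_of_le 0 (by simp))
  iInf_fil := eq_bot_iff.2 (iInf_le_of_le 1 (by simp))

/-- The period ring of the base datum is `E` itself (definitionally). [folklore] -/
lemma trivial_B : (trivial Γ P E).B = E := rfl

/-- The filtration of the base datum is the trivial filtration. [folklore] -/
lemma trivial_fil : (trivial Γ P E).fil = trivialFil E := rfl

variable {Γ P E}

/-- `Γ` acts trivially on the period ring of the base datum. [folklore] -/
@[simp] lemma trivial_smul (σ : Γ) (b : (trivial Γ P E).B) : σ • b = b := rfl

end Trivial

/-! ### Linear algebra of `E ⊗_P M` for the base datum -/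

section Linear

variable {Γ : Type u} [Group Γ] {P : Type v} {E : Type v'} [Field P] [Field E] [Algebra P E]
  {M : Type w'} [AddCommGroup M] [Module P M]

variable (Γ E) in
/-- `dim_E (B ⊗_P M) = dim_P M` for the base datum `B = E` (Mathlib `Module.finrank_baseChange`;
both sides are `0` when `M` is infinite-dimensional). [folklore] -/
lemma finrank_trivial_tensor :
    Module.finrank E ((trivial Γ P E).B ⊗[P] M) = Module.finrank P M :=
  Module.finrank_baseChange (R := (trivial Γ P E).B) (S := P) (M' := M)

variable (Γ E) in
/-- `m ↦ 1 ⊗ m : M → B ⊗_P M` is injective for the base datum `B = E` (indeed for any nonzero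
`P`-algebra; here via a `P`-linear retraction of `P → E`). [folklore] -/
lemma one_tmul_injective :
    Function.Injective fun m : M =>
      ((1 : (trivial Γ P E).B) ⊗ₜ[P] m : (trivial Γ P E).B ⊗[P] M) := by
  obtain ⟨g, hg⟩ := LinearMap.exists_leftInverse_of_injective
    (Algebra.linearMap P (trivial Γ P E).B)
    (LinearMap.ker_eq_bot.2 (algebraMap P (trivial Γ P E).B).injective)
  intro a b hab
  have h := congrArg (fun x => TensorProduct.lid P M (g.rTensor M x)) hab
  simp only [LinearMap.rTensor_tmul] at h
  have hg1 : g 1 = 1 := by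
    simpa using LinearMap.congr_fun hg (1 : P)
  simpa [hg1] using h

end Linear

/-! ### Admissibility for the base datum = triviality of the representation -/

section Admissible

variable {Γ : Type u} [Group Γ] [TopologicalSpace Γ] {P : Type v} {E : Type v'} [Field P]
  [TopologicalSpace P] [Field E] [Algebra P E]
  {M : Type w'} [AddCommGroup M] [Module P M] [TopologicalSpace M]
  (ρ : ContinuousRep Γ P M)

/-- On pure tensors the diagonal action for the base datum is `b ⊗ m ↦ b ⊗ ρ(σ) m` (the action on
`B = E` being trivial). [folklore] -/
@[simp] lemma tensorRep_trivial_tmul (σ : Γ) (b : (trivial Γ P E).B) (m : M) :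
    (trivial Γ P E).tensorRep ρ σ (b ⊗ₜ m) = b ⊗ₜ ρ σ m := rfl

/-- If `Γ` acts trivially on `M` then every element of `B ⊗_P M` is invariant for the base datum:
`D = B ⊗_P M`. [folklore] -/
lemma D_trivial_eq_top (h : ∀ (σ : Γ) (v : M), ρ σ v = v) : (trivial Γ P E).D ρ = ⊤ := by
  refine Submodule.eq_top_iff'.2 fun x => ((trivial Γ P E).mem_D_iff ρ x).2 fun σ => ?_
  induction x using TensorProduct.induction_on with
  | zero => simp
  | tmul b m => rw [tensorRep_trivial_tmul, h]
  | add x y hx hy => rw [map_add, hx, hy]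

/-- A representation on which `Γ` acts trivially is admissible for the base datum `B = E`:
`dim_E D = dim_E (E ⊗_P M) = dim_P M`.  (No finiteness hypothesis: both sides vanish for
infinite-dimensional `M`.) [folklore] -/
theorem isAdmissible_trivial_of_forall_eq (h : ∀ (σ : Γ) (v : M), ρ σ v = v) :
    (trivial Γ P E).IsAdmissible ρ := by
  unfold IsAdmissible
  rw [D_trivial_eq_top ρ h, finrank_top]
  exact finrank_trivial_tensor Γ E

variable (Γ P E M) in
/-- In particular the trivial representation (`ContinuousRep.trivial`) is admissible for the base
datum: the predicate `PeriodRingData.IsAdmissible` is satisfiable. [folklore] -/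
theorem isAdmissible_trivial_trivial :
    (trivial Γ P E).IsAdmissible (ContinuousRep.trivial Γ P M) :=
  isAdmissible_trivial_of_forall_eq _ fun _ _ => rfl

/-- Conversely, for finite-dimensional `M`, admissibility for the base datum `B = E` forces `Γ` to
act trivially on `M`: `D` has full dimension in the finite-dimensional `E`-space `E ⊗_P M`, hence
`D = E ⊗_P M`, so `1 ⊗ ρ(σ) v = 1 ⊗ v`, and `m ↦ 1 ⊗ m` is injective. [folklore] -/
theorem forall_eq_of_isAdmissible_trivial [FiniteDimensional P M]
    (h : (trivial Γ P E).IsAdmissible ρ) (σ : Γ) (v : M) : ρ σ v = v := by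
  haveI : Module.Finite E ((trivial Γ P E).B ⊗[P] M) :=
    Module.Finite.base_change (R := P) (A := (trivial Γ P E).B) (M := M)
  have htop : (trivial Γ P E).D ρ = ⊤ :=
    Submodule.eq_top_of_finrank_eq (h.trans (finrank_trivial_tensor Γ E).symm)
  have hmem : ((1 : (trivial Γ P E).B) ⊗ₜ[P] v : (trivial Γ P E).B ⊗[P] M) ∈ (trivial Γ P E).D ρ :=
    htop ▸ Submodule.mem_top
  have h1 := ((trivial Γ P E).mem_D_iff ρ _).1 hmem σ
  rw [tensorRep_trivial_tmul] at h1
  exact one_tmul_injective Γ E h1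

/-- **Admissibility for the base datum `B = E` is triviality**: for finite-dimensional `M`,
`(trivial Γ P E).IsAdmissible ρ ↔ Γ` acts trivially on `M` (informally,
`D_E(V) = E ⊗_P V^Γ`). [folklore] -/
theorem isAdmissible_trivial_iff [FiniteDimensional P M] :
    (trivial Γ P E).IsAdmissible ρ ↔ ∀ (σ : Γ) (v : M), ρ σ v = v :=
  ⟨forall_eq_of_isAdmissible_trivial ρ, isAdmissible_trivial_of_forall_eq ρ⟩

end Admissible

/-! ### A non-admissible representation; the universal closure is false -/

section SignRep

/-- The **sign character** of the discrete group `Multiplicative ℤ` on `ℚ`, `n ↦ (-1)^n`, as a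
continuous representation (jointly continuous because the group is discrete). [folklore] -/
def signRep : ContinuousRep (Multiplicative ℤ) ℚ ℚ where
  toRepresentation :=
    { toFun := fun n => ((-1 : ℚ) ^ (Multiplicative.toAdd n)) • LinearMap.id
      map_one' := by ext; simp
      map_mul' := fun a b => by
        ext
        simp [zpow_add₀ (show (-1 : ℚ) ≠ 0 by norm_num), mul_comm] }
  continuous_smul := continuous_prod_of_discrete_left.mpr fun n =>
    continuous_const_smul ((-1 : ℚ) ^ (Multiplicative.toAdd n))

/-- Unfolding lemma for `signRep`: `n` acts as multiplication by `(-1)^n`. [folklore] -/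
@[simp] lemma signRep_apply (n : Multiplicative ℤ) (x : ℚ) :
    signRep n x = (-1 : ℚ) ^ (Multiplicative.toAdd n) * x := rfl

/-- The sign character is **not** admissible for the base datum `B = ℚ` (`Γ = Multiplicative ℤ`,
`P = E = ℚ`): it is one-dimensional and non-trivial (`1 ↦ -1` under `n = 1`), so
`D = (ℚ ⊗ ℚ)^Γ = 0`. [folklore] -/
theorem not_isAdmissible_trivial_signRep :
    ¬ (trivial (Multiplicative ℤ) ℚ ℚ).IsAdmissible signRep := by
  intro h
  have h1 := forall_eq_of_isAdmissible_trivial signRep h (Multiplicative.ofAdd 1) 1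
  norm_num at h1

/-- **`B`-admissibility is not automatic.**  The universal closure of the predicate
`PeriodRingData.IsAdmissible` — "every continuous representation is admissible for every
period-ring datum" — is false, by `not_isAdmissible_trivial_signRep`.  (`IsAdmissible` is
Fontaine's *definition* of `B`-admissible, Astérisque 223 (1994), Exposé III, §1.5, not a
theorem; stated at universe level `0`.) [folklore] -/
theorem not_forall_isAdmissible :
    ¬ ∀ (Γ : Type) [Group Γ] [TopologicalSpace Γ] (P : Type) [Field P] [TopologicalSpace P]
        (E : Type) [Field E] [Algebra P E] (M : Type) [AddCommGroup M] [Module P M]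
        [TopologicalSpace M] (𝔅 : PeriodRingData.{0, 0, 0, 0} Γ P E) (ρ : ContinuousRep Γ P M),
        𝔅.IsAdmissible ρ :=
  fun h => not_isAdmissible_trivial_signRep (h _ ℚ ℚ ℚ _ signRep)

end SignRep

end PeriodRingData

end Literature.NumberTheory.GaloisRepresentations
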